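import Literature.MathematicalPhysics.QuantumManyBody.NeumannBoseGasCondensation
import Literature.MathematicalPhysics.QuantumManyBody.EnergyLocalizationProofs
import Literature.MathematicalPhysics.QuantumManyBody.GeneralizedPoincareProofs
import Literature.Barriers.AtomisticToContinuum.KineticGapLengthScalesAssembly
import HarnessLib

/-!
# The a priori pinned lower bound on Neumann boxes (first rung of Junge 2026, Thm. 4)

Topic `Literature/MathematicalPhysics/QuantumManyBody`, proofs file of `NeumannBoseGasCondensation.lean`
(provefact `Literature.MathematicalPhysics.QuantumManyBody.BoseGas.Junge2026_neumannBox_pinnedLowerBound`: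
Junge 2026 Thm. 4 at `T = 0`, i.e. the pinned form of [FournaisEtAl2024, Thm. 1.3]).

The printed proof of [FournaisEtAl2024, Thm. 1.3] (§2–§6: replacement by an integrable potential,
renormalised potential splitting, spectral gaps by localization of large matrices, 3Q localization,
symmetrization, Bogoliubov diagonalization) starts from an **a priori condensation estimate**,
[FournaisEtAl2024, Lemma 4.1], whose proof rests on the first-order pinned bound
`H_N ≥ 4πa N²ℓ⁻³ (1 - C(ρa³)^{1/17}) + C' n₊/ℓ²` ("as long as `N(ρa³)^{1/17} ≥ 1`, … which can be
found in [greenbook]" = [LSSY2005]): on a NEUMANN box this is LSSY's Lemma 5.2 (localization of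
energy) combined with the generalized Poincaré inequality Lemma 4.1 exactly as in the proof of
LSSY Thm. 5.1, (5.15)–(5.17), which LSSY state for "periodic (or Neumann)" boundary conditions.
The tree proves all the ingredients (`locLowerBound_neumann`, `LSSY2005_lemma41_holds`, and the
periodic assembly `Literature.Barriers.AtomisticToContinuum.BoseGas.depletion_le_of_lemma41`);
this file carries out the Neumann assembly:

* `locEnergy_add_kineticOutside_le_neumannEnergy` — (5.9) for a Neumann state:
  `[εT + (1-ε)(T^in + I)] + (1-ε)T^out ≤ ⟨Ψ, H_N Ψ⟩`;
* `sum_lintegral_sliceMeanSq_of_symm`, `NeumannTrialState.condensateOccupation_add_depletion` —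
  (5.17) for symmetric normalised Neumann states: `⟨Ψ, n₀Ψ⟩ + depletion = N`;
* `depletion_le_of_lemma41_contDiff` — (5.15), structural part, for `C¹` states without boundary
  condition (general Lemma 4.1): `depletion ≤ C (L² T^out + ((4π/3)NR³)^{2/3} T)`;
* `neumannBox_pinnedLowerBound_firstOrder` — **the bound itself**: for `v ≥ 0` of finite range
  with `0 < a < ∞` there are `δ, C, c > 0` such that for `Y = 4πρa³/3 < δ`, `N ≥ Y^{-1/17}` and
  every Bose-symmetric normalised `C¹` state `Ψ` on the Neumann box `Λ_L^N`,
  `4πρa(1 - CY^{1/17})N + (c/L²)N ≤ ⟨Ψ,H_NΨ⟩ + (c/L²)⟨Ψ,n₀Ψ⟩` (additive `ℝ≥0∞` form of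
  `⟨Ψ,H_NΨ⟩ ≥ 4πρa(1 - CY^{1/17})N + (c/L²)⟨Ψ,n₊Ψ⟩`, the shape of the vendored fact with the
  first-order error `Y^{1/17}` in place of `128/(15√π)√(ρa³) - C(ρa³)^{1/2+η}`);
* `neumannBox_pinnedLowerBound_firstOrder_gpBox` — the same on Junge's boxes
  `L = a(ρa³)^{-1/2-η}`, `ρa³ ≤ c₀` (the hypotheses of the vendored fact imply `Y < δ`, `N ≥ Y^{-1/17}`);
* `neumannBox_condensation_firstOrder` — the resulting condensation of near-minimisers on Neumann
  boxes (the Neumann half of the mechanism of LSSY Thm. 5.1; [FournaisEtAl2024, (4.3)]);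
* `neumannBox_condensation_of_energy_le` — the same condensation statement on any admissible
  Neumann box (`Y < δ`, `N ≥ Y^{-1/17}`) with an arbitrary energy excess `S`;
* `Junge2026_neumannBox_pinnedLowerBound.of_lowEnergy` — **the first reduction of the printed
  proof**: the vendored fact follows from its restriction to states of energy
  `≤ 4πρaN(1 + C₁(ρa³)^{1/17})` (available for every `C₁` and all small `η`), the high-energy
  states being settled by the first-order bound (`jungeBox_firstOrder_hypotheses`,
  `pinned_mono_coeff` are its bookkeeping lemmas).

What is NOT here: the second-order (Lee–Huang–Yang) analysis of [FournaisEtAl2024, §2–§6], i.e.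
the discharge `Junge2026_neumannBox_pinnedLowerBound_holds` itself (tracked in the provefact notes).
No new definitions.

## References

* [Junge2026] L. Junge, *Propagation of condensation via Neumann localization in the dilute Bose
  gas*, arXiv:2603.20776: Thm. 4, Rem. 5, eq. (25).
* [FournaisEtAl2024] S. Fournais, L. Junge, T. Girardot, L. Morin, M. Olivieri, A. Triay, *The free
  energy of dilute Bose gases at low temperatures interacting via strong potentials*,
  arXiv:2408.14222, Ann. Henri Poincaré (2026): Thm. 1.3, Lemma 4.1 and its proof ((4.1)–(4.3)).
* [LSSY2005] E. H. Lieb, R. Seiringer, J. P. Solovej, J. Yngvason, *The Mathematics of the Bose Gas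
  and its Condensation*, Birkhäuser 2005 (arXiv:cond-mat/0610117): Lemma 4.1 (4.2), Lemma 5.2
  (5.7)–(5.14), proof of Thm. 5.1 (5.15)–(5.17).
-/

noncomputable section

open MeasureTheory Filter Metric
open scoped ENNReal NNReal

namespace Literature.MathematicalPhysics.QuantumManyBody.BoseGas

open Literature.Barriers.AtomisticToContinuum.BoseGas

/-! ### (5.9) for a Neumann state -/

/-- **(5.9) on a Neumann box.** For a Neumann trial state `Ψ` and `0 ≤ ε ≤ 1`,
`[εT + (1-ε)(T^in_R + I)](Ψ) + (1-ε) T^out_R(Ψ) ≤ ⟨Ψ, H_N Ψ⟩`, since `T^in + T^out ≤ T`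
pointwise. [cite: LSSY2005, Lemma 5.2 (5.9)–(5.13)] -/
theorem locEnergy_add_kineticOutside_le_neumannEnergy {ε : ℝ} (hε0 : 0 ≤ ε) (hε1 : ε ≤ 1) (R : ℝ)
    {v : ℝ → ℝ≥0∞} (hv : Measurable v) {N : ℕ} {L : ℝ} (Ψ : NeumannTrialState N L) :
    locEnergy ε R v Ψ +
        ENNReal.ofReal (1 - ε) * ∫⁻ X in boxN N L, kineticOutside R Ψ.ψ X ≤
      neumannEnergy v Ψ := by
  have hsplit : ENNReal.ofReal ε + ENNReal.ofReal (1 - ε) = 1 := by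
    rw [← ENNReal.ofReal_add hε0 (by linarith), add_sub_cancel, ENNReal.ofReal_one]
  have hle1 : ENNReal.ofReal (1 - ε) ≤ 1 := ENNReal.ofReal_le_one.2 (by linarith)
  have hm1 : Measurable fun X => ENNReal.ofReal ε * kineticDensity Ψ.ψ X :=
    (measurable_kineticDensity Ψ.contDiff).const_mul _
  have hm2 : Measurable fun X => ENNReal.ofReal (1 - ε) *
      (kineticInside R Ψ.ψ X + interaction v X * (‖Ψ.ψ X‖₊ : ℝ≥0∞) ^ 2) :=
    ((measurable_kineticInside R Ψ.ψ).add
      ((measurable_interaction hv).mul (measurable_normSq Ψ.contDiff.continuous))).const_mul _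
  have hE : locEnergy ε R v Ψ +
      ENNReal.ofReal (1 - ε) * ∫⁻ X in boxN N L, kineticOutside R Ψ.ψ X =
      ∫⁻ X in boxN N L, (ENNReal.ofReal ε * kineticDensity Ψ.ψ X +
        ENNReal.ofReal (1 - ε) *
          (kineticInside R Ψ.ψ X + interaction v X * (‖Ψ.ψ X‖₊ : ℝ≥0∞) ^ 2)) +
        ENNReal.ofReal (1 - ε) * kineticOutside R Ψ.ψ X := by
    have hm12 : Measurable fun X => ENNReal.ofReal ε * kineticDensity Ψ.ψ X +
        ENNReal.ofReal (1 - ε) *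
          (kineticInside R Ψ.ψ X + interaction v X * (‖Ψ.ψ X‖₊ : ℝ≥0∞) ^ 2) := hm1.add hm2
    unfold locEnergy
    rw [← lintegral_const_mul' _ _ ENNReal.ofReal_ne_top,
      ← lintegral_const_mul' _ _ ENNReal.ofReal_ne_top,
      ← lintegral_const_mul' _ _ ENNReal.ofReal_ne_top, ← lintegral_add_left hm1,
      ← lintegral_add_left hm12]
  rw [hE]
  unfold neumannEnergy
  refine lintegral_mono fun X => ?_
  have hT := kineticInside_add_kineticOutside_le R Ψ.ψ X
  calc ENNReal.ofReal ε * kineticDensity Ψ.ψ X + ENNReal.ofReal (1 - ε) *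
        (kineticInside R Ψ.ψ X + interaction v X * (‖Ψ.ψ X‖₊ : ℝ≥0∞) ^ 2) +
        ENNReal.ofReal (1 - ε) * kineticOutside R Ψ.ψ X
      = ENNReal.ofReal ε * kineticDensity Ψ.ψ X +
          ENNReal.ofReal (1 - ε) * (kineticInside R Ψ.ψ X + kineticOutside R Ψ.ψ X) +
          ENNReal.ofReal (1 - ε) * (interaction v X * (‖Ψ.ψ X‖₊ : ℝ≥0∞) ^ 2) := by ring
    _ ≤ ENNReal.ofReal ε * kineticDensity Ψ.ψ X + ENNReal.ofReal (1 - ε) * kineticDensity Ψ.ψ X +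
          1 * (interaction v X * (‖Ψ.ψ X‖₊ : ℝ≥0∞) ^ 2) := by
        gcongr
    _ = kineticDensity Ψ.ψ X + interaction v X * (‖Ψ.ψ X‖₊ : ℝ≥0∞) ^ 2 := by
        rw [← add_mul, hsplit, one_mul, one_mul]

/-! ### (5.17) for symmetric Neumann states -/

/-- **The `P`-terms summed over the particles give `n₀`** for a Bose-symmetric continuous `Ψ`:
`∑ᵢ L⁻³ ∫_{K^N} L⁻³ |∫_K Ψ(…,xᵢ = x,…) dx|² dX = ⟨Ψ, n₀Ψ⟩` (all `N` terms equal the `i = 0` one;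
periodicity plays no role). [cite: LSSY2005, Ch. 5 (5.17)] -/
theorem sum_lintegral_sliceMeanSq_of_symm {n : ℕ} {L : ℝ} (hL : 0 < L) {Ψ : Config (n + 1) → ℂ}
    (hΨ : Continuous Ψ)
    (hsymm : ∀ (σ : Equiv.Perm (Fin (n + 1))) (X : Config (n + 1)), Ψ (X ∘ σ) = Ψ X) :
    ∑ i : Fin (n + 1), (ENNReal.ofReal L ^ 3)⁻¹ *
        ∫⁻ X in cellN (n + 1) L, (ENNReal.ofReal L ^ 3)⁻¹ *
          (‖∫ x in cell L, Ψ (Function.update X i x)‖₊ : ℝ≥0∞) ^ 2 =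
      condensateOccupation (n + 1) L Ψ := by
  have hL3 : ENNReal.ofReal L ^ 3 ≠ 0 := pow_ne_zero _ (by simpa using hL)
  have hL3' : ENNReal.ofReal L ^ 3 ≠ ⊤ := ENNReal.pow_ne_top ENNReal.ofReal_ne_top
  have hterm : ∀ i : Fin (n + 1),
      (ENNReal.ofReal L ^ 3)⁻¹ *
          ∫⁻ X in cellN (n + 1) L, (ENNReal.ofReal L ^ 3)⁻¹ *
            (‖∫ x in cell L, Ψ (Function.update X i x)‖₊ : ℝ≥0∞) ^ 2 =
        (ENNReal.ofReal L ^ 3)⁻¹ *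
          ∫⁻ Y in cellN n L, (‖∫ x in cell L, Ψ (Matrix.vecCons x Y)‖₊ : ℝ≥0∞) ^ 2 := by
    intro i
    rw [lintegral_const_mul' _ _ (ENNReal.inv_ne_top.2 hL3)]
    have h1 : (fun X => (‖∫ x in cell L, Ψ (Function.update X i x)‖₊ : ℝ≥0∞) ^ 2) =
        fun X => (‖∫ x in cell L, Ψ (Function.update (X ∘ Equiv.swap 0 i) 0 x)‖₊ : ℝ≥0∞) ^ 2 :=
      funext fun X => sliceMeanSq_eq_zero_comp_swap L i hsymm X
    rw [h1, lintegral_cellN_comp_perm (Equiv.swap 0 i)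
        (fun X => (‖∫ x in cell L, Ψ (Function.update X 0 x)‖₊ : ℝ≥0∞) ^ 2),
      lintegral_sliceMeanSq_zero L hΨ, ← mul_assoc, ← mul_assoc,
      mul_assoc _ _ (ENNReal.ofReal L ^ 3), ENNReal.inv_mul_cancel hL3 hL3', mul_one]
  simp only [hterm, Finset.sum_const, Finset.card_univ, Fintype.card_fin, nsmul_eq_mul]
  rw [condensateOccupation_succ hL]
  push_cast
  ring

/-- **(5.17) for a symmetric Neumann state:** `⟨Ψ, n₀Ψ⟩ + depletion = N` for a normalised
Bose-symmetric `C¹` state on the Neumann box `Λ_L^N` (the box `(0,L)^{3N}` and the cell `[0,L)^{3N}`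
over which `depletion` and `condensateOccupation` integrate differ by a null set).
[cite: LSSY2005, Ch. 5 (5.17)] -/
theorem NeumannTrialState.condensateOccupation_add_depletion {n : ℕ} {L : ℝ} (hL : 0 < L)
    (Ψ : NeumannTrialState (n + 1) L)
    (hsymm : ∀ (σ : Equiv.Perm (Fin (n + 1))) (X : Config (n + 1)), Ψ.ψ (X ∘ σ) = Ψ.ψ X) :
    condensateOccupation (n + 1) L Ψ.ψ + depletion (n + 1) L Ψ.ψ = ((n + 1 : ℕ) : ℝ≥0∞) := by
  have hL3 : ENNReal.ofReal L ^ 3 ≠ 0 := pow_ne_zero _ (by simpa using hL)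
  have hL3' : ENNReal.ofReal L ^ 3 ≠ ⊤ := ENNReal.pow_ne_top ENNReal.ofReal_ne_top
  have hcont : Continuous Ψ.ψ := Ψ.contDiff.continuous
  have hnorm : ∫⁻ X in cellN (n + 1) L, (‖Ψ.ψ X‖₊ : ℝ≥0∞) ^ 2 = 1 := by
    rw [← setLIntegral_congr (boxN_ae_eq_cellN (n + 1) L)]; exact Ψ.norm_eq
  -- each slice term is `1`
  have hone : ∀ i : Fin (n + 1), (ENNReal.ofReal L ^ 3)⁻¹ *
      ∫⁻ X in cellN (n + 1) L, ∫⁻ x in cell L, (‖Ψ.ψ (Function.update X i x)‖₊ : ℝ≥0∞) ^ 2 = 1 := by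
    intro i
    rw [lintegral_normSq_slice i hcont.measurable, hnorm, mul_one,
      ENNReal.inv_mul_cancel hL3 hL3']
  have hN : ((n + 1 : ℕ) : ℝ≥0∞) = ∑ i : Fin (n + 1), (ENNReal.ofReal L ^ 3)⁻¹ *
      ∫⁻ X in cellN (n + 1) L, ∫⁻ x in cell L, (‖Ψ.ψ (Function.update X i x)‖₊ : ℝ≥0∞) ^ 2 := by
    simp only [hone, Finset.sum_const, Finset.card_univ, Fintype.card_fin, nsmul_eq_mul, mul_one]
  -- split each slice by the variance identity
  have hsplit : ∀ (i : Fin (n + 1)) (X : Config (n + 1)),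
      ∫⁻ x in cell L, (‖Ψ.ψ (Function.update X i x)‖₊ : ℝ≥0∞) ^ 2 =
        (∫⁻ x in cell L, (‖Ψ.ψ (Function.update X i x) -
            ⨍ y in cell L, Ψ.ψ (Function.update X i y)‖₊ : ℝ≥0∞) ^ 2) +
          (ENNReal.ofReal L ^ 3)⁻¹ *
            (‖∫ x in cell L, Ψ.ψ (Function.update X i x)‖₊ : ℝ≥0∞) ^ 2 := fun i X =>
    lintegral_nnnorm_sq_cell_eq hL (hcont.comp (continuous_const.update i continuous_id))
  have hmeas : ∀ i : Fin (n + 1), Measurable fun X : Config (n + 1) =>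
      (ENNReal.ofReal L ^ 3)⁻¹ *
        (‖∫ x in cell L, Ψ.ψ (Function.update X i x)‖₊ : ℝ≥0∞) ^ 2 := fun i =>
    (measurable_sliceMeanSq L i hcont).const_mul _
  rw [hN, ← sum_lintegral_sliceMeanSq_of_symm hL hcont hsymm, depletion, ← Finset.sum_add_distrib]
  refine Finset.sum_congr rfl fun i _ => ?_
  rw [← mul_add, ← lintegral_add_left' (hmeas i).aemeasurable]
  congr 1
  refine lintegral_congr fun X => ?_
  rw [hsplit i X, add_comm]

/-- In particular `⟨Ψ, n₀Ψ⟩ ≤ N` for symmetric normalised Neumann states (also `N = 0`).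
[cite: LSSY2005, Ch. 5 (5.17)] -/
theorem NeumannTrialState.condensateOccupation_le_card {N : ℕ} {L : ℝ} (hL : 0 < L)
    (Ψ : NeumannTrialState N L)
    (hsymm : ∀ (σ : Equiv.Perm (Fin N)) (X : Config N), Ψ.ψ (X ∘ σ) = Ψ.ψ X) :
    condensateOccupation N L Ψ.ψ ≤ (N : ℝ≥0∞) := by
  cases N with
  | zero => simp [condensateOccupation, occupation]
  | succ n => exact (Ψ.condensateOccupation_add_depletion hL hsymm) ▸ le_self_add

/-! ### (5.15) from the general Lemma 4.1 -/

/-- **(5.15), structural part, without boundary conditions.** If the generalized Poincaré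
inequality (Lemma 4.1) holds with constant `C` for all `C¹` functions on the cube, then for every
`C¹` `N`-body function `Ψ` (`N ≥ 2`) and every `R`,
`depletion ≤ C (L² T^out + ((4π/3)NR³)^{2/3} T)`, `T^out = ∫_{K^N} ∑ᵢ 1_{tᵢ ≥ R}|∇ᵢΨ|²`,
`T = ∫_{K^N} |∇Ψ|²`: Lemma 4.1 applied to every slice `xᵢ ↦ Ψ` with `Ω = Ω_{X,i}`,
`|K ∖ Ω_{X,i}| ≤ (4π/3)NR³`, integrated over the other variables (the periodic argument of
`Literature.Barriers.AtomisticToContinuum.BoseGas.depletion_le_of_lemma41`, verbatim, with the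
general Lemma 4.1). [cite: LSSY2005, Ch. 5 (5.15)] -/
theorem depletion_le_of_lemma41_contDiff {C : ℝ}
    (h41 : ∀ (L : ℝ), 0 < L → ∀ (f : Space → ℂ), ContDiff ℝ 1 f →
      ∀ (Ω : Set Space), MeasurableSet Ω → Ω ⊆ cell L →
        ∫⁻ x in cell L, (‖f x - ⨍ y in cell L, f y‖₊ : ℝ≥0∞) ^ 2 ≤
          ENNReal.ofReal C *
            (ENNReal.ofReal (L ^ 2) * (∫⁻ x in Ω, gradSqC f x) +
              volume (cell L \ Ω) ^ (2 / 3 : ℝ) * ∫⁻ x in cell L, gradSqC f x))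
    {N : ℕ} (hN : 1 < N) {L : ℝ} (hL : 0 < L) (R : ℝ) {Ψ : Config N → ℂ}
    (hΨ : ContDiff ℝ 1 Ψ) :
    depletion N L Ψ ≤ ENNReal.ofReal C *
      (ENNReal.ofReal (L ^ 2) * (∫⁻ X in cellN N L, kineticOutside R Ψ X) +
        encounterVolume N R ^ (2 / 3 : ℝ) * ∫⁻ X in cellN N L, kineticDensity Ψ X) := by
  have hL3 : ENNReal.ofReal L ^ 3 ≠ 0 := pow_ne_zero _ (by simpa using hL)
  have hL3' : ENNReal.ofReal L ^ 3 ≠ ⊤ := ENNReal.pow_ne_top ENNReal.ofReal_ne_top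
  have hdiff : Differentiable ℝ Ψ := hΨ.differentiable one_ne_zero
  set G : Fin N → Config N → ℝ≥0∞ := fun i =>
    {Y : Config N | R ≤ nnDist Y i}.indicator (partialGradSq i Ψ) with hG
  have hGm : ∀ i, Measurable (G i) := fun i =>
    (measurable_partialGradSq i Ψ).indicator (measurableSet_le_nnDist R i)
  -- Lemma 4.1 on one slice, in transported form
  have hslice : ∀ (i : Fin N) (X : Config N),
      ∫⁻ x in cell L, (‖Ψ (Function.update X i x) -
          ⨍ y in cell L, Ψ (Function.update X i y)‖₊ : ℝ≥0∞) ^ 2 ≤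
        ENNReal.ofReal C *
          (ENNReal.ofReal (L ^ 2) * (∫⁻ x in cell L, G i (Function.update X i x)) +
            encounterVolume N R ^ (2 / 3 : ℝ) *
              ∫⁻ x in cell L, partialGradSq i Ψ (Function.update X i x)) := by
    intro i X
    have hsl : ContDiff ℝ 1 fun x => Ψ (Function.update X i x) :=
      hΨ.comp (contDiff_update 1 X i)
    have h := h41 L hL _ hsl
      (cell L ∩ farSet R X i) ((measurableSet_cell L).inter (measurableSet_farSet R X i))
      Set.inter_subset_left
    refine h.trans ?_
    gcongr ENNReal.ofReal C * (ENNReal.ofReal (L ^ 2) * ?_ + ?_ * ?_)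
    · refine le_of_eq ?_
      rw [Set.inter_comm, ← Measure.restrict_restrict (measurableSet_farSet R X i),
        ← lintegral_indicator (measurableSet_farSet R X i)]
      exact lintegral_congr fun x => indicator_farSet_gradSqC_slice hdiff R X i x
    · rw [Set.sdiff_self_inter]
      exact ENNReal.rpow_le_rpow (volume_cell_diff_farSet_le hN L R X i) (by norm_num)
    · exact le_of_eq (lintegral_congr fun x => gradSqC_slice hdiff X i x)
  -- integrate over the other variables and sum over the particles
  have hEV : encounterVolume N R ^ (2 / 3 : ℝ) ≠ ⊤ :=
    ENNReal.rpow_ne_top_of_nonneg (by norm_num) (ENNReal.mul_ne_top (ENNReal.natCast_ne_top N)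
      (ENNReal.mul_ne_top (ENNReal.pow_ne_top ENNReal.ofReal_ne_top) ENNReal.ofReal_ne_top))
  have hterm : ∀ i : Fin N, (ENNReal.ofReal L ^ 3)⁻¹ *
      ∫⁻ X in cellN N L, ∫⁻ x in cell L, (‖Ψ (Function.update X i x) -
          ⨍ y in cell L, Ψ (Function.update X i y)‖₊ : ℝ≥0∞) ^ 2 ≤
        ENNReal.ofReal C *
          (ENNReal.ofReal (L ^ 2) * (∫⁻ X in cellN N L, G i X) +
            encounterVolume N R ^ (2 / 3 : ℝ) * ∫⁻ X in cellN N L, partialGradSq i Ψ X) := by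
    intro i
    have hm : Measurable fun X : Config N => ENNReal.ofReal (L ^ 2) *
        ∫⁻ x in cell L, G i (Function.update X i x) :=
      (measurable_lintegral_cell_update L i (hGm i)).const_mul _
    calc (ENNReal.ofReal L ^ 3)⁻¹ *
          ∫⁻ X in cellN N L, ∫⁻ x in cell L, (‖Ψ (Function.update X i x) -
            ⨍ y in cell L, Ψ (Function.update X i y)‖₊ : ℝ≥0∞) ^ 2
        ≤ (ENNReal.ofReal L ^ 3)⁻¹ * ∫⁻ X in cellN N L, ENNReal.ofReal C *
            (ENNReal.ofReal (L ^ 2) * (∫⁻ x in cell L, G i (Function.update X i x)) +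
              encounterVolume N R ^ (2 / 3 : ℝ) *
                ∫⁻ x in cell L, partialGradSq i Ψ (Function.update X i x)) :=
          mul_le_mul_right (lintegral_mono fun X => hslice i X) _
      _ = (ENNReal.ofReal L ^ 3)⁻¹ * (ENNReal.ofReal L ^ 3 * (ENNReal.ofReal C *
            (ENNReal.ofReal (L ^ 2) * (∫⁻ X in cellN N L, G i X) +
              encounterVolume N R ^ (2 / 3 : ℝ) * ∫⁻ X in cellN N L, partialGradSq i Ψ X))) := by
          rw [lintegral_const_mul' _ _ ENNReal.ofReal_ne_top, lintegral_add_left hm,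
            lintegral_const_mul' _ _ ENNReal.ofReal_ne_top, lintegral_const_mul' _ _ hEV,
            lintegral_cellN_lintegral_update i (hGm i),
            lintegral_cellN_lintegral_update i (measurable_partialGradSq i Ψ),
            mul_left_comm (ENNReal.ofReal (L ^ 2)), mul_left_comm (encounterVolume N R ^ (2 / 3 : ℝ)),
            ← mul_add, mul_left_comm (ENNReal.ofReal C)]
      _ = _ := by rw [← mul_assoc, ENNReal.inv_mul_cancel hL3 hL3', one_mul]
  -- sum over the particles
  have hsumG : ∑ i : Fin N, ∫⁻ X in cellN N L, G i X = ∫⁻ X in cellN N L, kineticOutside R Ψ X := by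
    rw [← lintegral_finsetSum _ fun i _ => hGm i]
    rfl
  have hsumT : ∑ i : Fin N, ∫⁻ X in cellN N L, partialGradSq i Ψ X =
      ∫⁻ X in cellN N L, kineticDensity Ψ X := by
    rw [← lintegral_finsetSum _ fun i _ => measurable_partialGradSq i Ψ]
    rfl
  calc depletion N L Ψ ≤ ∑ i : Fin N, ENNReal.ofReal C *
        (ENNReal.ofReal (L ^ 2) * (∫⁻ X in cellN N L, G i X) +
          encounterVolume N R ^ (2 / 3 : ℝ) * ∫⁻ X in cellN N L, partialGradSq i Ψ X) :=
        Finset.sum_le_sum fun i _ => hterm i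
    _ = _ := by
        rw [← hsumG, ← hsumT, Finset.mul_sum, Finset.mul_sum, ← Finset.sum_add_distrib,
          ← Finset.mul_sum]

/-! ### The first-order pinned lower bound on a Neumann box -/

/-- Exponent bookkeeping for the encounter volume with `R = aY^{-5/17}`:
`(4π/3) N R³ = L³ Y^{2/17}` and hence `((4π/3) N R³)^{2/3} = L² Y^{4/51}`
(`Y = 4πρa³/3`, `ρ = N/L³`). [folklore] -/
theorem encounterVolumeReal_rpow_two_thirds {N : ℕ} {L a Y : ℝ} (hL : 0 < L) (hY : 0 < Y) (hY_def : Y = 4 * Real.pi * ((N : ℝ) / L ^ 3) * a ^ 3 / 3) :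
    encounterVolumeReal N (a * Y ^ (-(5 : ℝ) / 17)) ^ (2 / 3 : ℝ) =
      L ^ 2 * Y ^ ((4 : ℝ) / 51) := by
  have hev : encounterVolumeReal N (a * Y ^ (-(5 : ℝ) / 17)) = L ^ 3 * Y ^ ((2 : ℝ) / 17) := by
    unfold encounterVolumeReal
    have h3 : (a * Y ^ (-(5 : ℝ) / 17)) ^ 3 = a ^ 3 * Y ^ (-(15 : ℝ) / 17) := by
      rw [mul_pow, ← Real.rpow_natCast (Y ^ (-(5 : ℝ) / 17)) 3, ← Real.rpow_mul hY.le]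
      norm_num
    have hNa : (N : ℝ) * a ^ 3 * (Real.pi * 4 / 3) = Y * L ^ 3 := by
      rw [hY_def]; field_simp
    have h2 : Y * Y ^ (-(15 : ℝ) / 17) = Y ^ ((2 : ℝ) / 17) := by
      conv_lhs => rw [show Y * Y ^ (-(15 : ℝ) / 17) = Y ^ (1 : ℝ) * Y ^ (-(15 : ℝ) / 17) by
        rw [Real.rpow_one]]
      rw [← Real.rpow_add hY]
      norm_num
    calc (N : ℝ) * ((a * Y ^ (-(5 : ℝ) / 17)) ^ 3 * (Real.pi * 4 / 3))
        = (N : ℝ) * a ^ 3 * (Real.pi * 4 / 3) * Y ^ (-(15 : ℝ) / 17) := by rw [h3]; ring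
      _ = L ^ 3 * (Y * Y ^ (-(15 : ℝ) / 17)) := by rw [hNa]; ring
      _ = L ^ 3 * Y ^ ((2 : ℝ) / 17) := by rw [h2]
  rw [hev, Real.mul_rpow (by positivity) (Real.rpow_nonneg hY.le _),
    ← Real.rpow_natCast L 3, ← Real.rpow_mul hL.le, ← Real.rpow_mul hY.le]
  norm_num

/-- **The a priori pinned lower bound on a Neumann box (first order).** Let `v ≥ 0` be a radial
pair potential of finite range with scattering length `0 < a < ∞`. There are `δ, C, c > 0` such
that for all `N`, `L > 0` with `Y = 4πρa³/3 < δ` (`ρ = N/L³`) and `N ≥ Y^{-1/17}`, every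
Bose-symmetric normalised `C¹` state `Ψ` on the Neumann box `Λ_L^N = (0,L)^{3N}` satisfies
`⟨Ψ, H_N Ψ⟩ ≥ 4πρa(1 - C Y^{1/17}) N + (c/L²) ⟨Ψ, n₊Ψ⟩`, written additively in `ℝ≥0∞` with
`⟨Ψ, n₊Ψ⟩ = N - ⟨Ψ, n₀Ψ⟩`:
`4πρa(1 - CY^{1/17})N + (c/L²)N ≤ ⟨Ψ,H_NΨ⟩ + (c/L²)⟨Ψ,n₀Ψ⟩`.
This is the bound "`H_N ≥ 4πa N²ℓ⁻³(1 - C(ρa³)^{1/17}) + C' n₊/ℓ²` as long as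
`N(ρa³)^{1/17} ≥ 1`, which can be found in [greenbook]" on which the a priori condensation
estimate [FournaisEtAl2024, Lemma 4.1] — the first step of the proof of Junge's Theorem 4 —
rests; in LSSY it is the combination (5.15)–(5.17) of Lemma 5.2 and Lemma 4.1 in the proof of
Thm. 5.1 ("periodic (or Neumann) boundary conditions"), here for the Neumann box. Proof:
`ε = y = Y^{1/17}`, `R = aY^{-5/17}`; `4πρa(1 - C₁y)N + (1-y)T^out ≤ ⟨Ψ,HΨ⟩`
(`locLowerBound_neumann` and (5.9)); `N - n₀ = depletion ≤ C₄(L²T^out + ((4π/3)NR³)^{2/3}T)`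
(Lemma 4.1 on slices) with `((4π/3)NR³)^{2/3} = L²Y^{4/51}`; and
`⟨Ψ,HΨ⟩ = (1-θ)⟨Ψ,HΨ⟩ + θ⟨Ψ,HΨ⟩ ≥ (1-θ)[4πρa(1-C₁y)N + (1-y)T^out] + θT` with `θ = Y^{4/51}/4`,
`c = 1/(4C₄)`, `C = C₁ + 1`, `δ = min(δ₁, 2^{-17})`.
[cite: LSSY2005, Ch. 5, proof of Thm. 5.1 (5.15)–(5.17), Lemma 5.2 (5.7), Lemma 4.1 (4.2)] -/
theorem neumannBox_pinnedLowerBound_firstOrder :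
    ∀ (v : ℝ → ℝ≥0∞), IsRepulsiveFiniteRange v → scatteringLength v ≠ ⊤ →
      0 < scatteringLength v →
    ∃ δ C c : ℝ, 0 < δ ∧ 0 < C ∧ 0 < c ∧
      ∀ (N : ℕ) (L : ℝ), 0 < L →
        let a := (scatteringLength v).toReal
        let ρ := (N : ℝ) / L ^ 3
        let Y := 4 * Real.pi * ρ * a ^ 3 / 3
        Y < δ → Y ^ (-(1 : ℝ) / 17) ≤ N →
        ∀ Ψ : NeumannTrialState N L,
          (∀ (σ : Equiv.Perm (Fin N)) (X : Config N), Ψ.ψ (X ∘ σ) = Ψ.ψ X) →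
          ENNReal.ofReal (4 * Real.pi * ρ * a * (1 - C * Y ^ ((1 : ℝ) / 17)) * N) +
              ENNReal.ofReal (c / L ^ 2) * (N : ℝ≥0∞) ≤
            neumannEnergy v Ψ + ENNReal.ofReal (c / L ^ 2) * condensateOccupation N L Ψ.ψ := by
  intro v hv hfin hapos
  have hmeas : Measurable v := hv.1
  obtain ⟨δ₁, C₁, hδ₁, hC₁, H⟩ := locLowerBound_neumann v hv
  obtain ⟨C₄, hC₄, h41⟩ := LSSY2005_lemma41_holds
  refine ⟨min δ₁ ((1 / 2 : ℝ) ^ 17), C₁ + 1, 1 / (4 * C₄), lt_min hδ₁ (by positivity),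
    by linarith, by positivity, ?_⟩
  intro N L hL a ρ Y hYδ hYN Ψ hsymm
  have ha_def : a = (scatteringLength v).toReal := rfl
  have hρ_def : ρ = N / L ^ 3 := rfl
  have hY_def : Y = 4 * Real.pi * ρ * a ^ 3 / 3 := rfl
  have ha : 0 < a := by rw [ha_def]; exact ENNReal.toReal_pos hapos.ne' hfin
  -- `N = 0` is trivial
  rcases Nat.eq_zero_or_pos N with hN0 | hNpos
  · subst hN0; simp
  have hNr : (0 : ℝ) < N := Nat.cast_pos.2 hNpos
  have hρ : 0 < ρ := by rw [hρ_def]; positivity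
  have hY0 : 0 < Y := by rw [hY_def]; positivity
  have hYδ₁ : Y < δ₁ := lt_of_lt_of_le hYδ (min_le_left _ _)
  have hYhalf : Y < (1 / 2 : ℝ) ^ 17 := lt_of_lt_of_le hYδ (min_le_right _ _)
  have hY1 : Y ≤ 1 := hYhalf.le.trans (by norm_num)
  -- `y = Y^{1/17} < 1/2`
  set y := Y ^ ((1 : ℝ) / 17) with hy_def
  have hy0 : 0 < y := Real.rpow_pos_of_pos hY0 _
  obtain ⟨hy17, -, -⟩ := rpow_seventeenth hY0.le
  have hyhalf : y < 1 / 2 := by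
    refine lt_of_pow_lt_pow_left₀ 17 (by norm_num) ?_
    rw [hy17]; exact hYhalf
  -- `N ≥ Y^{-1/17} = y⁻¹ > 2`, so `N ≥ 2`
  have hN2 : 1 < N := by
    have h1 : Y ^ (-(1 : ℝ) / 17) = y⁻¹ := by
      rw [hy_def, ← Real.rpow_neg hY0.le]; norm_num
    have h2 : (2 : ℝ) < y⁻¹ := by
      rw [lt_inv_comm₀ (by norm_num) hy0]
      exact hyhalf.trans_eq (by norm_num)
    have h3 : (2 : ℝ) < N := h2.trans_le (h1 ▸ hYN)
    exact_mod_cast (show (1 : ℝ) < N by linarith)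
  -- the box-size condition from `N ≥ Y^{-1/17}`
  have hL' : Y ^ (-(6 : ℝ) / 17) < L / a := rpow_lt_div_of_le hNpos hL ha hYN
  obtain ⟨n, rfl⟩ : ∃ n, N = n + 1 := ⟨N - 1, (Nat.succ_pred_eq_of_pos hNpos).symm⟩
  -- names
  set R : ℝ := a * Y ^ (-(5 : ℝ) / 17) with hR_def
  have hR0 : 0 ≤ R := by positivity
  set E := neumannEnergy v Ψ with hE_def
  set Tout := ∫⁻ X in boxN (n + 1) L, kineticOutside R Ψ.ψ X with hTout_def
  set T := ∫⁻ X in boxN (n + 1) L, kineticDensity Ψ.ψ X with hT_def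
  set n₀ := condensateOccupation (n + 1) L Ψ.ψ with hn₀_def
  set D := depletion (n + 1) L Ψ.ψ with hD_def
  set κ := ENNReal.ofReal (1 / (4 * C₄) / L ^ 2) with hκ_def
  set B := ENNReal.ofReal (4 * Real.pi * ρ * a * (1 - C₁ * y) * ((n + 1 : ℕ) : ℝ)) with hB_def
  -- (i) Lemma 5.2's bound for the localized functional on the Neumann box, and (5.9)
  have h1 : B + ENNReal.ofReal (1 - y) * Tout ≤ E := by
    have hmain := H (n + 1) L hL hYδ₁ hL'
    have h59 := locEnergy_add_kineticOutside_le_neumannEnergy hy0.le (by linarith) R hmeas Ψ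
    calc B + ENNReal.ofReal (1 - y) * Tout
        ≤ locGroundStateEnergy y R v (n + 1) L + ENNReal.ofReal (1 - y) * Tout :=
          add_le_add hmain le_rfl
      _ ≤ locEnergy y R v Ψ + ENNReal.ofReal (1 - y) * Tout :=
          add_le_add (locGroundStateEnergy_le y R v Ψ) le_rfl
      _ ≤ E := h59
  -- (ii) `T ≤ ⟨Ψ,HΨ⟩`
  have hT : T ≤ E := lintegral_mono fun X => le_self_add
  -- (iii) (5.17): `n₀ + depletion = N`
  have h3 : n₀ + D = ((n + 1 : ℕ) : ℝ≥0∞) := Ψ.condensateOccupation_add_depletion hL hsymm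
  -- (iv) (5.15): the depletion bound, transported from the cell to the box
  have hbox : ∀ F : Config (n + 1) → ℝ≥0∞,
      ∫⁻ X in cellN (n + 1) L, F X = ∫⁻ X in boxN (n + 1) L, F X :=
    fun F => (setLIntegral_congr (boxN_ae_eq_cellN (n + 1) L)).symm
  have h2 : D ≤ ENNReal.ofReal C₄ * (ENNReal.ofReal (L ^ 2) * Tout +
      encounterVolume (n + 1) R ^ (2 / 3 : ℝ) * T) := by
    have := depletion_le_of_lemma41_contDiff h41 hN2 hL R Ψ.contDiff
    rwa [hbox, hbox] at this
  -- the encounter-volume factor `((4π/3)NR³)^{2/3} = L² Y^{4/51}` and `θ = Y^{4/51}/4`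
  set θ := Y ^ ((4 : ℝ) / 51) / 4 with hθ_def
  have hY451_0 : 0 ≤ Y ^ ((4 : ℝ) / 51) := Real.rpow_nonneg hY0.le _
  have hθ0 : 0 ≤ θ := by positivity
  have hY451 : Y ^ ((4 : ℝ) / 51) ≤ y := by
    rw [hy_def]; exact Real.rpow_le_rpow_of_exponent_ge hY0 hY1 (by norm_num)
  have hθy : θ ≤ y := by rw [hθ_def]; linarith
  have hθ4 : θ ≤ 1 / 4 := by
    have : Y ^ ((4 : ℝ) / 51) ≤ 1 := Real.rpow_le_one hY0.le hY1 (by norm_num)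
    rw [hθ_def]; linarith
  have hEV : encounterVolume (n + 1) R ^ (2 / 3 : ℝ) =
      ENNReal.ofReal (L ^ 2 * Y ^ ((4 : ℝ) / 51)) := by
    rw [encounterVolume_eq_ofReal _ hR0,
      ENNReal.ofReal_rpow_of_nonneg (encounterVolumeReal_nonneg _ hR0) (by norm_num), hR_def,
      encounterVolumeReal_rpow_two_thirds hL hY0 rfl]
  -- (v) `κ · depletion ≤ ¼ T^out + θ T`
  have hκ4 : κ * ENNReal.ofReal C₄ * ENNReal.ofReal (L ^ 2) = ENNReal.ofReal (1 / 4) := by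
    rw [hκ_def, ← ENNReal.ofReal_mul (by positivity), ← ENNReal.ofReal_mul (by positivity)]
    congr 1
    field_simp
  have hκθ : κ * ENNReal.ofReal C₄ * ENNReal.ofReal (L ^ 2 * Y ^ ((4 : ℝ) / 51)) =
      ENNReal.ofReal θ := by
    rw [hκ_def, ← ENNReal.ofReal_mul (by positivity), ← ENNReal.ofReal_mul (by positivity)]
    congr 1
    rw [hθ_def]
    field_simp
  have hA : κ * D ≤ ENNReal.ofReal (1 / 4) * Tout + ENNReal.ofReal θ * T := by
    calc κ * D ≤ κ * (ENNReal.ofReal C₄ * (ENNReal.ofReal (L ^ 2) * Tout +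
          encounterVolume (n + 1) R ^ (2 / 3 : ℝ) * T)) := mul_le_mul_right h2 κ
      _ = κ * ENNReal.ofReal C₄ * ENNReal.ofReal (L ^ 2) * Tout +
          κ * ENNReal.ofReal C₄ * encounterVolume (n + 1) R ^ (2 / 3 : ℝ) * T := by ring
      _ = ENNReal.ofReal (1 / 4) * Tout + ENNReal.ofReal θ * T := by rw [hκ4, hEV, hκθ]
  -- (vi) `⟨Ψ,HΨ⟩ = (1-θ)⟨Ψ,HΨ⟩ + θ⟨Ψ,HΨ⟩ ≥ (1-θ)[B + (1-y)T^out] + θT ≥ (1-θ)B + κ·depletion`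
  have hsplitθ : ENNReal.ofReal (1 - θ) + ENNReal.ofReal θ = 1 := by
    rw [← ENNReal.ofReal_add (by linarith) hθ0, sub_add_cancel, ENNReal.ofReal_one]
  have h14 : ENNReal.ofReal (1 / 4) ≤ ENNReal.ofReal ((1 - θ) * (1 - y)) :=
    ENNReal.ofReal_le_ofReal (by nlinarith)
  have hBC : ENNReal.ofReal (1 - θ) * B + κ * ((n + 1 : ℕ) : ℝ≥0∞) ≤ E + κ * n₀ := by
    calc ENNReal.ofReal (1 - θ) * B + κ * ((n + 1 : ℕ) : ℝ≥0∞)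
        = ENNReal.ofReal (1 - θ) * B + κ * D + κ * n₀ := by rw [← h3]; ring
      _ ≤ ENNReal.ofReal (1 - θ) * B + (ENNReal.ofReal (1 / 4) * Tout + ENNReal.ofReal θ * T) +
            κ * n₀ := by gcongr
      _ ≤ ENNReal.ofReal (1 - θ) * B + (ENNReal.ofReal ((1 - θ) * (1 - y)) * Tout +
            ENNReal.ofReal θ * T) + κ * n₀ := by gcongr
      _ = ENNReal.ofReal (1 - θ) * (B + ENNReal.ofReal (1 - y) * Tout) + ENNReal.ofReal θ * T +
            κ * n₀ := by rw [ENNReal.ofReal_mul (by linarith)]; ring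
      _ ≤ ENNReal.ofReal (1 - θ) * E + ENNReal.ofReal θ * E + κ * n₀ := by gcongr
      _ = E + κ * n₀ := by rw [← add_mul, hsplitθ, one_mul]
  -- (vii) `(1-θ)(1 - C₁y) ≥ 1 - (C₁+1)y` in the relevant sense
  have hD' : ENNReal.ofReal (4 * Real.pi * ρ * a * (1 - (C₁ + 1) * y) * ((n + 1 : ℕ) : ℝ)) ≤
      ENNReal.ofReal (1 - θ) * B := by
    rw [hB_def, ← ENNReal.ofReal_mul (by linarith)]
    refine ENNReal.ofReal_le_ofReal ?_
    have hP : 0 ≤ 4 * Real.pi * ρ * a * ((n + 1 : ℕ) : ℝ) := by positivity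
    have hkey : θ * (1 - C₁ * y) ≤ y := by
      rcases le_or_gt 0 (1 - C₁ * y) with h | h
      · calc θ * (1 - C₁ * y) ≤ θ * 1 := by
              refine mul_le_mul_of_nonneg_left ?_ hθ0
              nlinarith [hC₁, hy0]
          _ ≤ y := by linarith
      · have : θ * (1 - C₁ * y) ≤ 0 := mul_nonpos_of_nonneg_of_nonpos hθ0 h.le
        linarith
    nlinarith [mul_le_mul_of_nonneg_left hkey hP]
  calc ENNReal.ofReal (4 * Real.pi * ρ * a * (1 - (C₁ + 1) * y) * ((n + 1 : ℕ) : ℝ)) +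
        κ * ((n + 1 : ℕ) : ℝ≥0∞)
      ≤ ENNReal.ofReal (1 - θ) * B + κ * ((n + 1 : ℕ) : ℝ≥0∞) := add_le_add hD' le_rfl
    _ ≤ E + κ * n₀ := hBC

/-! ### On Junge's boxes `L = a(ρa³)^{-1/2-η}` -/

/-- **The first-order pinned bound on the boxes of the vendored fact.** In the setting of
`Junge2026_neumannBox_pinnedLowerBound` — `N ≥ 1` bosons on the Neumann box of side
`L = a(ρa³)^{-1/2-η}`, `ρ = N/L³`, `ρa³ ≤ c` — the hypotheses `Y < δ` and `N ≥ Y^{-1/17}` of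
`neumannBox_pinnedLowerBound_firstOrder` hold (`Y = (4π/3)ρa³`, `N = (ρa³)^{-1/2-3η}`), so
`4πρaN(1 - C(ρa³)^{1/17}) + (c₁/L²)N ≤ ⟨Ψ,H_NΨ⟩ + (c₁/L²)⟨Ψ,n₀Ψ⟩` for every Bose-symmetric
normalised Neumann state: the shape of Junge's Theorem 4 at `T = 0` with the first-order error
`C(ρa³)^{1/17}` in place of `-(128/(15√π))√(ρa³) + C(ρa³)^{1/2+η}` and pinning coefficient `c₁`
in place of `η` (the a priori input (4.3) of [FournaisEtAl2024, Lemma 4.1]).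
[cite: LSSY2005, Ch. 5, proof of Thm. 5.1 (5.15)–(5.17)] -/
theorem neumannBox_pinnedLowerBound_firstOrder_gpBox :
    ∀ (v : ℝ → ℝ≥0∞), IsRepulsiveFiniteRange v → scatteringLength v ≠ ⊤ →
      0 < scatteringLength v → ∀ η : ℝ, 0 < η →
    ∃ C c₁ c : ℝ, 0 < C ∧ 0 < c₁ ∧ 0 < c ∧
      ∀ (N : ℕ) (L : ℝ), 0 < N → 0 < L →
        let a := (scatteringLength v).toReal
        let ρ := (N : ℝ) / L ^ 3
        ρ * a ^ 3 ≤ c →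
        L = a * (ρ * a ^ 3) ^ (-(1 / 2 + η)) →
        ∀ Ψ : NeumannTrialState N L,
          (∀ (σ : Equiv.Perm (Fin N)) (X : Config N), Ψ.ψ (X ∘ σ) = Ψ.ψ X) →
          ENNReal.ofReal (4 * Real.pi * ρ * a * N * (1 - C * (ρ * a ^ 3) ^ ((1 : ℝ) / 17))) +
              ENNReal.ofReal (c₁ / L ^ 2) * (N : ℝ≥0∞) ≤
            neumannEnergy v Ψ + ENNReal.ofReal (c₁ / L ^ 2) * condensateOccupation N L Ψ.ψ := by
  intro v hv hfin hapos η hη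
  obtain ⟨δ, C, c₁, hδ, hC, hc₁, H⟩ := neumannBox_pinnedLowerBound_firstOrder v hv hfin hapos
  have hpi := Real.pi_pos
  refine ⟨C * (4 * Real.pi / 3) ^ ((1 : ℝ) / 17), c₁, min (3 * δ / (8 * Real.pi)) 1,
    by positivity, hc₁, lt_min (by positivity) one_pos, ?_⟩
  intro N L hN hL a ρ hdil hbox Ψ hsymm
  have ha_def : a = (scatteringLength v).toReal := rfl
  have hρ_def : ρ = N / L ^ 3 := rfl
  have ha : 0 < a := by rw [ha_def]; exact ENNReal.toReal_pos hapos.ne' hfin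
  have hNr : (0 : ℝ) < N := Nat.cast_pos.2 hN
  have hL0 : L ≠ 0 := hL.ne'
  have hρ : 0 < ρ := by rw [hρ_def]; positivity
  set t := ρ * a ^ 3 with ht_def
  have ht0 : 0 < t := by positivity
  have ht1 : t ≤ 1 := hdil.trans (min_le_right _ _)
  have htδ : t ≤ 3 * δ / (8 * Real.pi) := hdil.trans (min_le_left _ _)
  have hYt : 4 * Real.pi * ρ * a ^ 3 / 3 = (4 * Real.pi / 3) * t := by rw [ht_def]; ring
  -- `Y = (4π/3) t < δ`
  have hY : 4 * Real.pi * ρ * a ^ 3 / 3 < δ := by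
    rw [hYt]
    calc 4 * Real.pi / 3 * t ≤ 4 * Real.pi / 3 * (3 * δ / (8 * Real.pi)) := by gcongr
      _ = δ / 2 := by field_simp; ring
      _ < δ := by linarith
  -- `N = t^{-(1/2+3η)} ≥ t^{-1/17} ≥ Y^{-1/17}`
  have hNt : (N : ℝ) = t ^ (-(1 / 2 + 3 * η)) := by
    have hL3 : L ^ 3 = a ^ 3 * t ^ (-(3 * (1 / 2 + η))) := by
      rw [hbox, mul_pow, ← Real.rpow_natCast (t ^ (-(1 / 2 + η))) 3, ← Real.rpow_mul ht0.le]
      congr 1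
      push_cast
      ring
    have hNρ : (N : ℝ) = ρ * L ^ 3 := by rw [hρ_def]; field_simp
    rw [hNρ, hL3, ← mul_assoc, ← ht_def]
    conv_lhs => rw [show t * t ^ (-(3 * (1 / 2 + η))) = t ^ (1 : ℝ) * t ^ (-(3 * (1 / 2 + η))) by
      rw [Real.rpow_one]]
    rw [← Real.rpow_add ht0]
    congr 1
    ring
  have hYN : (4 * Real.pi * ρ * a ^ 3 / 3) ^ (-(1 : ℝ) / 17) ≤ N := by
    have h1 : (4 * Real.pi * ρ * a ^ 3 / 3) ^ (-(1 : ℝ) / 17) =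
        (4 * Real.pi / 3) ^ (-(1 : ℝ) / 17) * t ^ (-(1 : ℝ) / 17) := by
      rw [hYt]
      exact Real.mul_rpow (by positivity) ht0.le
    have h2 : (4 * Real.pi / 3) ^ (-(1 : ℝ) / 17) ≤ 1 :=
      Real.rpow_le_one_of_one_le_of_nonpos (by nlinarith [Real.pi_gt_three]) (by norm_num)
    have h3 : t ^ (-(1 : ℝ) / 17) ≤ t ^ (-(1 / 2 + 3 * η)) :=
      Real.rpow_le_rpow_of_exponent_ge ht0 ht1 (by linarith)
    have h4 : 0 ≤ t ^ (-(1 : ℝ) / 17) := Real.rpow_nonneg ht0.le _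
    calc (4 * Real.pi * ρ * a ^ 3 / 3) ^ (-(1 : ℝ) / 17)
        = (4 * Real.pi / 3) ^ (-(1 : ℝ) / 17) * t ^ (-(1 : ℝ) / 17) := h1
      _ ≤ 1 * t ^ (-(1 : ℝ) / 17) := mul_le_mul_of_nonneg_right h2 h4
      _ ≤ t ^ (-(1 / 2 + 3 * η)) := by rw [one_mul]; exact h3
      _ = N := hNt.symm
  have hmain := H N L hL hY hYN Ψ hsymm
  -- constants: `C Y^{1/17} = C (4π/3)^{1/17} t^{1/17}`
  have hCY : 4 * Real.pi * ρ * a * N * (1 - C * (4 * Real.pi / 3) ^ ((1 : ℝ) / 17) *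
      t ^ ((1 : ℝ) / 17)) =
      4 * Real.pi * ρ * a * (1 - C * (4 * Real.pi * ρ * a ^ 3 / 3) ^ ((1 : ℝ) / 17)) * N := by
    rw [hYt, Real.mul_rpow (by positivity) ht0.le]
    ring
  rw [hCY]
  exact hmain

/-- **First-order condensation of near-minimisers on Neumann boxes** (the Neumann half of the
mechanism of LSSY Thm. 5.1, and the zero-temperature content of the a priori estimate
[FournaisEtAl2024, Lemma 4.1]): with the constants of
`neumannBox_pinnedLowerBound_firstOrder_gpBox`, on the box `L = a(ρa³)^{-1/2-η}`, `ρa³ ≤ c`,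
every Bose-symmetric normalised Neumann state with
`⟨Ψ, H_N Ψ⟩ ≤ 4πρaN + C₀ ρaN (ρa³)^{1/17}` has
`⟨Ψ, n₊Ψ⟩ ≤ C ρ a L² (ρa³)^{1/17} N` (`= C (ρa³)^{1/17-2η} N`), i.e.
`N ≤ ⟨Ψ, n₀Ψ⟩ + C ρ a L² (ρa³)^{1/17} N`, `C = (4πC' + C₀)/c₁` — the first-order counterpart
of `Junge2026_neumannBox_pinnedLowerBound.condensation`, proved.
[cite: LSSY2005, Ch. 5, proof of Thm. 5.1 (5.15)–(5.17)] -/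
theorem neumannBox_condensation_firstOrder :
    ∀ (v : ℝ → ℝ≥0∞), IsRepulsiveFiniteRange v → scatteringLength v ≠ ⊤ →
      0 < scatteringLength v → ∀ (η C₀ : ℝ), 0 < η → 0 ≤ C₀ →
    ∃ C c : ℝ, 0 < C ∧ 0 < c ∧
      ∀ (N : ℕ) (L : ℝ), 0 < N → 0 < L →
        let a := (scatteringLength v).toReal
        let ρ := (N : ℝ) / L ^ 3
        ρ * a ^ 3 ≤ c →
        L = a * (ρ * a ^ 3) ^ (-(1 / 2 + η)) →
        ∀ Ψ : NeumannTrialState N L,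
          (∀ (σ : Equiv.Perm (Fin N)) (X : Config N), Ψ.ψ (X ∘ σ) = Ψ.ψ X) →
          neumannEnergy v Ψ ≤ ENNReal.ofReal (4 * Real.pi * ρ * a * N +
              C₀ * ρ * a * N * (ρ * a ^ 3) ^ ((1 : ℝ) / 17)) →
          (N : ℝ≥0∞) ≤ condensateOccupation N L Ψ.ψ +
              ENNReal.ofReal (C * ρ * a * L ^ 2 * (ρ * a ^ 3) ^ ((1 : ℝ) / 17) * N) := by
  intro v hv hfin hapos η C₀ hη hC₀
  obtain ⟨C, c₁, c, hC, hc₁, hc, hmain⟩ :=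
    neumannBox_pinnedLowerBound_firstOrder_gpBox v hv hfin hapos η hη
  refine ⟨(4 * Real.pi * C + C₀) / c₁, c, by positivity, hc, ?_⟩
  intro N L hN hL a ρ hdil hbox Ψ hsymm hE
  have hpin := hmain N L hN hL hdil hbox Ψ hsymm
  set t : ℝ := (ρ * a ^ 3) ^ ((1 : ℝ) / 17) with ht
  set R : ℝ := 4 * Real.pi * ρ * a * N * (1 - C * t) with hRdef
  set S : ℝ := 4 * Real.pi * ρ * a * N * C * t + C₀ * ρ * a * N * t with hSdef
  have hk0 : ENNReal.ofReal (c₁ / L ^ 2) ≠ 0 := by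
    rw [ne_eq, ENNReal.ofReal_eq_zero, not_le]; positivity
  have hsplit : 4 * Real.pi * ρ * a * N + C₀ * ρ * a * N * t = R + S := by
    rw [hRdef, hSdef]; ring
  have hE' : neumannEnergy v Ψ ≤ ENNReal.ofReal R + ENNReal.ofReal S := by
    refine hE.trans ?_
    rw [hsplit]
    exact ENNReal.ofReal_add_le
  have hcore := Junge2026_neumannBox_pinnedLowerBound.le_add_inv_mul_of_pinned
    ENNReal.ofReal_ne_top hk0 ENNReal.ofReal_ne_top hpin hE'
  refine hcore.trans (le_of_eq ?_)
  congr 1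
  rw [← ENNReal.ofReal_inv_of_pos (by positivity), ← ENNReal.ofReal_mul (by positivity)]
  congr 1
  rw [hSdef]
  field_simp

/-! ### The first reduction of the printed proof: restriction to low-energy states -/

/-- **Junge's boxes satisfy the hypotheses of the first-order bound.** For `N ≥ 1` particles with
`t = ρa³ ≤ min(3δ/(8π), 1)` on the box `L = a t^{-1/2-η}` one has `Y = (4π/3)t < δ` and
`N = t^{-1/2-3η} ≥ t^{-1/17} ≥ Y^{-1/17}`. [folklore] -/
theorem jungeBox_firstOrder_hypotheses {N : ℕ} {L a δ η : ℝ} (hN : 0 < N) (hL : 0 < L)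
    (ha : 0 < a) (hη : 0 < η) (htδ : (N : ℝ) / L ^ 3 * a ^ 3 ≤ 3 * δ / (8 * Real.pi))
    (ht1 : (N : ℝ) / L ^ 3 * a ^ 3 ≤ 1)
    (hbox : L = a * ((N : ℝ) / L ^ 3 * a ^ 3) ^ (-(1 / 2 + η))) :
    4 * Real.pi * ((N : ℝ) / L ^ 3) * a ^ 3 / 3 < δ ∧
      (4 * Real.pi * ((N : ℝ) / L ^ 3) * a ^ 3 / 3) ^ (-(1 : ℝ) / 17) ≤ N := by
  have hpi := Real.pi_pos
  have hNr : (0 : ℝ) < N := Nat.cast_pos.2 hN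
  have hL0 : L ≠ 0 := hL.ne'
  set t := (N : ℝ) / L ^ 3 * a ^ 3 with ht_def
  have ht0 : 0 < t := by positivity
  have hYt : 4 * Real.pi * ((N : ℝ) / L ^ 3) * a ^ 3 / 3 = (4 * Real.pi / 3) * t := by
    rw [ht_def]; ring
  refine ⟨?_, ?_⟩
  · rw [hYt]
    have hδ : 0 < δ := by
      have : 0 < 3 * δ / (8 * Real.pi) := ht0.trans_le htδ
      have h8 : 0 < 8 * Real.pi := by positivity
      have := (div_pos_iff_of_pos_right h8).1 this
      linarith
    calc 4 * Real.pi / 3 * t ≤ 4 * Real.pi / 3 * (3 * δ / (8 * Real.pi)) := by gcongr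
      _ = δ / 2 := by field_simp; ring
      _ < δ := by linarith
  · have hNt : (N : ℝ) = t ^ (-(1 / 2 + 3 * η)) := by
      have hL3 : L ^ 3 = a ^ 3 * t ^ (-(3 * (1 / 2 + η))) := by
        rw [hbox, mul_pow, ← Real.rpow_natCast (t ^ (-(1 / 2 + η))) 3, ← Real.rpow_mul ht0.le]
        congr 1
        push_cast
        ring
      have ha3 : a ^ 3 ≠ 0 := by positivity
      have hNρ : (N : ℝ) = t / a ^ 3 * L ^ 3 := by rw [ht_def]; field_simp
      rw [hNρ, hL3, show t / a ^ 3 * (a ^ 3 * t ^ (-(3 * (1 / 2 + η)))) =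
        t * t ^ (-(3 * (1 / 2 + η))) by field_simp]
      conv_lhs => rw [show t * t ^ (-(3 * (1 / 2 + η))) =
        t ^ (1 : ℝ) * t ^ (-(3 * (1 / 2 + η))) by rw [Real.rpow_one]]
      rw [← Real.rpow_add ht0]
      congr 1
      ring
    have h1 : (4 * Real.pi * ((N : ℝ) / L ^ 3) * a ^ 3 / 3) ^ (-(1 : ℝ) / 17) =
        (4 * Real.pi / 3) ^ (-(1 : ℝ) / 17) * t ^ (-(1 : ℝ) / 17) := by
      rw [hYt]
      exact Real.mul_rpow (by positivity) ht0.le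
    have h2 : (4 * Real.pi / 3) ^ (-(1 : ℝ) / 17) ≤ 1 :=
      Real.rpow_le_one_of_one_le_of_nonpos (by nlinarith [Real.pi_gt_three]) (by norm_num)
    have h3 : t ^ (-(1 : ℝ) / 17) ≤ t ^ (-(1 / 2 + 3 * η)) :=
      Real.rpow_le_rpow_of_exponent_ge ht0 ht1 (by linarith)
    have h4 : 0 ≤ t ^ (-(1 : ℝ) / 17) := Real.rpow_nonneg ht0.le _
    calc (4 * Real.pi * ((N : ℝ) / L ^ 3) * a ^ 3 / 3) ^ (-(1 : ℝ) / 17)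
        = (4 * Real.pi / 3) ^ (-(1 : ℝ) / 17) * t ^ (-(1 : ℝ) / 17) := h1
      _ ≤ 1 * t ^ (-(1 : ℝ) / 17) := mul_le_mul_of_nonneg_right h2 h4
      _ ≤ t ^ (-(1 / 2 + 3 * η)) := by rw [one_mul]; exact h3
      _ = N := hNt.symm

/-- From `x + μ N ≤ E + μ n₀` with `n₀ ≤ N < ∞`, the pinning coefficient may be lowered:
`x + κ N ≤ E + κ n₀` for every `κ ≤ μ < ∞`. [folklore] -/
theorem pinned_mono_coeff {x E μ κ N n₀ : ℝ≥0∞} (hκμ : κ ≤ μ) (hμ : μ ≠ ⊤) (hN : N ≠ ⊤)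
    (hn₀ : n₀ ≤ N) (h : x + μ * N ≤ E + μ * n₀) : x + κ * N ≤ E + κ * n₀ := by
  obtain ⟨ν, rfl⟩ : ∃ ν, μ = κ + ν := ⟨μ - κ, (add_tsub_cancel_of_le hκμ).symm⟩
  have hν : ν ≠ ⊤ := fun h' => hμ (by rw [h', add_top])
  have hνN : ν * N ≠ ⊤ := ENNReal.mul_ne_top hν hN
  have h' : x + κ * N + ν * N ≤ E + κ * n₀ + ν * N :=
    calc x + κ * N + ν * N = x + (κ + ν) * N := by ring
      _ ≤ E + (κ + ν) * n₀ := h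
      _ = E + κ * n₀ + ν * n₀ := by ring
      _ ≤ E + κ * n₀ + ν * N := by gcongr
  exact (ENNReal.add_le_add_iff_right hνN).1 h'

/-- **The first reduction of the printed proof: it suffices to treat low-energy states.**
Junge's Theorem 4 at `T = 0` (`Junge2026_neumannBox_pinnedLowerBound`) follows from its
restriction to Bose-symmetric Neumann states of energy
`⟨Ψ, H_N Ψ⟩ ≤ 4πρaN(1 + C₁(ρa³)^{1/17})` — the states to which the a priori condensation
estimate [FournaisEtAl2024, Lemma 4.1] applies and on which the second-order analysis of
[FournaisEtAl2024, §2–§6] is carried out — provided that restricted bound is available for every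
threshold `C₁` and all small `η` (as the printed proof gives: [FournaisEtAl2024, Thm. 1.3] holds
for all `0 < η < 1/1026`; [Junge2026, Rem. 5]: `η ≤ 1/32` at `T = 0`). For the remaining
high-energy states the first-order pinned bound `neumannBox_pinnedLowerBound_firstOrder`
suffices: averaging it with `⟨Ψ,H_NΨ⟩ > 4πρaN(1 + C₁(ρa³)^{1/17})` for
`C₁ = C_r + 2·128/(15√π)` gives `⟨Ψ,H_NΨ⟩ ≥ 4πρaN(1 + (128/(15√π))(ρa³)^{1/17}) + (c₁/2L²)⟨Ψ,n₊Ψ⟩`,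
which dominates the claimed right side since `(ρa³)^{1/2} ≤ (ρa³)^{1/17}` and `η ≤ c₁/2`.
[cite: FournaisEtAl2024, Lemma 4.1 and proof (4.1)–(4.3)] -/
theorem Junge2026_neumannBox_pinnedLowerBound.of_lowEnergy
    (h : ∀ (v : ℝ → ℝ≥0∞), IsRepulsiveFiniteRange v → AntitoneOn v (Set.Ici 0) →
      scatteringLength v ≠ ⊤ → 0 < scatteringLength v →
      ∀ C₁ : ℝ, 0 ≤ C₁ →
      ∃ η₀ : ℝ, 0 < η₀ ∧ ∀ η : ℝ, 0 < η → η ≤ η₀ →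
      ∃ C c : ℝ, 0 < C ∧ 0 < c ∧
        ∀ (N : ℕ) (L : ℝ), 0 < N → 0 < L →
          let a := (scatteringLength v).toReal
          let ρ := (N : ℝ) / L ^ 3
          ρ * a ^ 3 ≤ c →
          L = a * (ρ * a ^ 3) ^ (-(1 / 2 + η)) →
          ∀ Ψ : NeumannTrialState N L,
            (∀ (σ : Equiv.Perm (Fin N)) (X : Config N), Ψ.ψ (X ∘ σ) = Ψ.ψ X) →
            neumannEnergy v Ψ ≤ ENNReal.ofReal (4 * Real.pi * ρ * a * N *
                (1 + C₁ * (ρ * a ^ 3) ^ ((1 : ℝ) / 17))) →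
            ENNReal.ofReal (4 * Real.pi * ρ * a * N *
                  (1 + 128 / (15 * Real.sqrt Real.pi) * Real.sqrt (ρ * a ^ 3)
                    - C * (ρ * a ^ 3) ^ (1 / 2 + η)))
                + ENNReal.ofReal (η / L ^ 2) * (N : ℝ≥0∞)
              ≤ neumannEnergy v Ψ + ENNReal.ofReal (η / L ^ 2) * condensateOccupation N L Ψ.ψ) :
    Junge2026_neumannBox_pinnedLowerBound := by
  intro v hv hmono hatop hapos
  have hpi := Real.pi_pos
  -- rung 0: the first-order pinned bound, constants `δ, C₀, c₁` depending on `v` only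
  obtain ⟨δ, C₀, c₁, hδ, hC₀, hc₁, H0⟩ := neumannBox_pinnedLowerBound_firstOrder v hv hatop hapos
  set ℓhy : ℝ := 128 / (15 * Real.sqrt Real.pi) with hℓhy_def
  have hℓhy : 0 < ℓhy := by positivity
  set Cr : ℝ := C₀ * (4 * Real.pi / 3) ^ ((1 : ℝ) / 17) with hCr_def
  have hCr : 0 < Cr := by positivity
  -- the low-energy bound at threshold `C₁ = C_r + 2ℓhy`, for `η = min(η₀, c₁/2)`
  obtain ⟨η₀, hη₀, Hη⟩ := h v hv hmono hatop hapos (Cr + 2 * ℓhy) (by positivity)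
  set η : ℝ := min η₀ (c₁ / 2) with hη_def
  have hη : 0 < η := lt_min hη₀ (by positivity)
  have hηη₀ : η ≤ η₀ := min_le_left _ _
  have hηc₁ : η ≤ c₁ / 2 := min_le_right _ _
  obtain ⟨C, c, hC, hc, Hlow⟩ := Hη η hη hηη₀
  refine ⟨C, η, min c (min (3 * δ / (8 * Real.pi)) 1), hC, hη,
    lt_min hc (lt_min (by positivity) one_pos), ?_⟩
  intro N L hN hL a ρ hdil hbox Ψ hsymm
  have ha_def : a = (scatteringLength v).toReal := rfl
  have hρ_def : ρ = N / L ^ 3 := rfl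
  have ha : 0 < a := by rw [ha_def]; exact ENNReal.toReal_pos hapos.ne' hatop
  have hNr : (0 : ℝ) < N := Nat.cast_pos.2 hN
  have hρ : 0 < ρ := by rw [hρ_def]; positivity
  have hdil_c : ρ * a ^ 3 ≤ c := hdil.trans (min_le_left _ _)
  have hdil_δ : ρ * a ^ 3 ≤ 3 * δ / (8 * Real.pi) :=
    hdil.trans ((min_le_right _ _).trans (min_le_left _ _))
  have hdil_1 : ρ * a ^ 3 ≤ 1 := hdil.trans ((min_le_right _ _).trans (min_le_right _ _))
  -- low-energy states: the hypothesis
  by_cases hlowE : neumannEnergy v Ψ ≤ ENNReal.ofReal (4 * Real.pi * ρ * a * N *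
      (1 + (Cr + 2 * ℓhy) * (ρ * a ^ 3) ^ ((1 : ℝ) / 17)))
  · exact Hlow N L hN hL hdil_c hbox Ψ hsymm hlowE
  -- high-energy states: rung 0
  have hhigh := not_le.1 hlowE
  obtain ⟨hY, hYN⟩ := jungeBox_firstOrder_hypotheses (δ := δ) hN hL ha hη hdil_δ hdil_1 hbox
  have hr0 := H0 N L hL hY hYN Ψ hsymm
  set t := ρ * a ^ 3 with ht_def
  have ht0 : 0 < t := by positivity
  set E := neumannEnergy v Ψ with hE_def
  set n₀ := condensateOccupation N L Ψ.ψ with hn₀_def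
  set P : ℝ := 4 * Real.pi * ρ * a * N with hP_def
  have hP : 0 ≤ P := by positivity
  set κ := ENNReal.ofReal (c₁ / L ^ 2) with hκ_def
  set κ' := ENNReal.ofReal (η / L ^ 2) with hκ'_def
  set Br := ENNReal.ofReal (4 * Real.pi * ρ * a * (1 - C₀ *
    (4 * Real.pi * ρ * a ^ 3 / 3) ^ ((1 : ℝ) / 17)) * N) with hBr_def
  set half := ENNReal.ofReal (1 / 2) with hhalf_def
  have hhalf2 : half + half = 1 := by
    rw [hhalf_def, ← ENNReal.ofReal_add (by norm_num) (by norm_num)]; norm_num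
  -- average the two lower bounds on `E`
  have havg : half * Br + half * ENNReal.ofReal (P * (1 + (Cr + 2 * ℓhy) * t ^ ((1 : ℝ) / 17))) +
      half * κ * N ≤ E + half * κ * n₀ := by
    have h1 : half * (Br + κ * N) ≤ half * (E + κ * n₀) := mul_le_mul_right hr0 half
    have h2 : half * ENNReal.ofReal (P * (1 + (Cr + 2 * ℓhy) * t ^ ((1 : ℝ) / 17))) ≤ half * E :=
      mul_le_mul_right hhigh.le half
    calc half * Br + half * ENNReal.ofReal (P * (1 + (Cr + 2 * ℓhy) * t ^ ((1 : ℝ) / 17))) +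
          half * κ * N
        = half * (Br + κ * N) +
            half * ENNReal.ofReal (P * (1 + (Cr + 2 * ℓhy) * t ^ ((1 : ℝ) / 17))) := by ring
      _ ≤ half * (E + κ * n₀) + half * E := add_le_add h1 h2
      _ = (half + half) * E + half * κ * n₀ := by ring
      _ = E + half * κ * n₀ := by rw [hhalf2, one_mul]
  -- lower the pinning coefficient from `c₁/2` to `η`
  have hκ'le : κ' ≤ half * κ := by
    rw [hκ'_def, hhalf_def, hκ_def, ← ENNReal.ofReal_mul (by norm_num)]
    refine ENNReal.ofReal_le_ofReal ?_
    rw [show 1 / 2 * (c₁ / L ^ 2) = (c₁ / 2) / L ^ 2 by ring]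
    exact div_le_div_of_nonneg_right hηc₁ (by positivity)
  have hμtop : half * κ ≠ ⊤ := ENNReal.mul_ne_top ENNReal.ofReal_ne_top ENNReal.ofReal_ne_top
  have hn₀N : n₀ ≤ (N : ℝ≥0∞) := Ψ.condensateOccupation_le_card hL hsymm
  have hlow' : half * Br + half * ENNReal.ofReal (P * (1 + (Cr + 2 * ℓhy) * t ^ ((1 : ℝ) / 17))) +
      κ' * N ≤ E + κ' * n₀ := by
    refine pinned_mono_coeff hκ'le hμtop (ENNReal.natCast_ne_top N) hn₀N ?_
    simpa only [mul_assoc] using havg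
  -- the claimed main term is below the average of the two first-order main terms
  have hmainle : ENNReal.ofReal (P * (1 + ℓhy * Real.sqrt t - C * t ^ (1 / 2 + η))) ≤
      half * Br + half * ENNReal.ofReal (P * (1 + (Cr + 2 * ℓhy) * t ^ ((1 : ℝ) / 17))) := by
    have hYt : 4 * Real.pi * ρ * a ^ 3 / 3 = (4 * Real.pi / 3) * t := by rw [ht_def]; ring
    have hBr_real : 4 * Real.pi * ρ * a * (1 - C₀ * (4 * Real.pi * ρ * a ^ 3 / 3) ^ ((1 : ℝ) / 17)) * N =
        P * (1 - Cr * t ^ ((1 : ℝ) / 17)) := by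
      rw [hYt, Real.mul_rpow (by positivity) ht0.le, hP_def, hCr_def]; ring
    have hsqrt : Real.sqrt t ≤ t ^ ((1 : ℝ) / 17) := by
      rw [Real.sqrt_eq_rpow]
      exact Real.rpow_le_rpow_of_exponent_ge ht0 hdil_1 (by norm_num)
    have ht17 : 0 ≤ t ^ ((1 : ℝ) / 17) := Real.rpow_nonneg ht0.le _
    have hCt : 0 ≤ C * t ^ (1 / 2 + η) := mul_nonneg hC.le (Real.rpow_nonneg ht0.le _)
    have hreal : P * (1 + ℓhy * Real.sqrt t - C * t ^ (1 / 2 + η)) ≤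
        1 / 2 * (P * (1 - Cr * t ^ ((1 : ℝ) / 17))) +
          1 / 2 * (P * (1 + (Cr + 2 * ℓhy) * t ^ ((1 : ℝ) / 17))) := by
      have : 1 / 2 * (P * (1 - Cr * t ^ ((1 : ℝ) / 17))) +
          1 / 2 * (P * (1 + (Cr + 2 * ℓhy) * t ^ ((1 : ℝ) / 17))) =
          P * (1 + ℓhy * t ^ ((1 : ℝ) / 17)) := by ring
      rw [this]
      refine mul_le_mul_of_nonneg_left ?_ hP
      nlinarith [mul_le_mul_of_nonneg_left hsqrt hℓhy.le]
    calc ENNReal.ofReal (P * (1 + ℓhy * Real.sqrt t - C * t ^ (1 / 2 + η)))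
        ≤ ENNReal.ofReal (1 / 2 * (P * (1 - Cr * t ^ ((1 : ℝ) / 17))) +
            1 / 2 * (P * (1 + (Cr + 2 * ℓhy) * t ^ ((1 : ℝ) / 17)))) := ENNReal.ofReal_le_ofReal hreal
      _ ≤ ENNReal.ofReal (1 / 2 * (P * (1 - Cr * t ^ ((1 : ℝ) / 17)))) +
            ENNReal.ofReal (1 / 2 * (P * (1 + (Cr + 2 * ℓhy) * t ^ ((1 : ℝ) / 17)))) :=
          ENNReal.ofReal_add_le
      _ = half * Br + half * ENNReal.ofReal (P * (1 + (Cr + 2 * ℓhy) * t ^ ((1 : ℝ) / 17))) := by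
          rw [hhalf_def, hBr_def, hBr_real, ← ENNReal.ofReal_mul (by norm_num),
            ← ENNReal.ofReal_mul (by norm_num)]
  calc ENNReal.ofReal (4 * Real.pi * ρ * a * N *
          (1 + 128 / (15 * Real.sqrt Real.pi) * Real.sqrt t - C * t ^ (1 / 2 + η))) + κ' * N
      ≤ half * Br + half * ENNReal.ofReal (P * (1 + (Cr + 2 * ℓhy) * t ^ ((1 : ℝ) / 17))) +
          κ' * N := add_le_add hmainle le_rfl
    _ ≤ E + κ' * n₀ := hlow'

/-! ### Condensation of near-minimisers on a general Neumann box -/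

/-- **First-order condensation on any admissible Neumann box** (for consumers working with cells
of other side lengths than Junge's, e.g. Fournais's `L = C_L(ρa³)^{-δ}(ρa)^{-1/2}`): with the
constants `δ, c` of `neumannBox_pinnedLowerBound_firstOrder` and `C = 4πC'/c`, for every `N`,
`L > 0` with `Y = 4πρa³/3 < δ`, `N ≥ Y^{-1/17}`, every Bose-symmetric normalised Neumann state and
every energy excess `S` with `⟨Ψ, H_N Ψ⟩ ≤ 4πρaN + S`,
`N ≤ ⟨Ψ, n₀Ψ⟩ + C ρ a L² Y^{1/17} N + (L²/c) S`, i.e.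
`⟨Ψ, n₊Ψ⟩ ≤ C ρaL² Y^{1/17} N + (L²/c) S` — (5.15)–(5.16) of the proof of LSSY Thm. 5.1 on a
Neumann box, before any limit is taken. [cite: LSSY2005, Ch. 5, proof of Thm. 5.1 (5.15)–(5.16)] -/
theorem neumannBox_condensation_of_energy_le :
    ∀ (v : ℝ → ℝ≥0∞), IsRepulsiveFiniteRange v → scatteringLength v ≠ ⊤ →
      0 < scatteringLength v →
    ∃ δ C c : ℝ, 0 < δ ∧ 0 < C ∧ 0 < c ∧
      ∀ (N : ℕ) (L : ℝ), 0 < L →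
        let a := (scatteringLength v).toReal
        let ρ := (N : ℝ) / L ^ 3
        let Y := 4 * Real.pi * ρ * a ^ 3 / 3
        Y < δ → Y ^ (-(1 : ℝ) / 17) ≤ N →
        ∀ Ψ : NeumannTrialState N L,
          (∀ (σ : Equiv.Perm (Fin N)) (X : Config N), Ψ.ψ (X ∘ σ) = Ψ.ψ X) →
          ∀ S : ℝ≥0∞, neumannEnergy v Ψ ≤ ENNReal.ofReal (4 * Real.pi * ρ * a * N) + S →
          (N : ℝ≥0∞) ≤ condensateOccupation N L Ψ.ψ +
            ENNReal.ofReal (C * ρ * a * L ^ 2 * Y ^ ((1 : ℝ) / 17) * N) +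
              ENNReal.ofReal (L ^ 2 / c) * S := by
  intro v hv hfin hapos
  obtain ⟨δ, C₁, c, hδ, hC₁, hc, H⟩ := neumannBox_pinnedLowerBound_firstOrder v hv hfin hapos
  refine ⟨δ, 4 * Real.pi * C₁ / c, c, hδ, by positivity, hc, ?_⟩
  intro N L hL a ρ Y hY hYN Ψ hsymm S hE
  have ha0 : 0 ≤ a := ENNReal.toReal_nonneg
  have hρ0 : 0 ≤ ρ := by positivity
  have hY0 : 0 ≤ Y := by positivity
  have hpin := H N L hL hY hYN Ψ hsymm
  set y := Y ^ ((1 : ℝ) / 17) with hy_def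
  have hy0 : 0 ≤ y := Real.rpow_nonneg hY0 _
  set R : ℝ := 4 * Real.pi * ρ * a * (1 - C₁ * y) * N with hR_def
  set W : ℝ := 4 * Real.pi * ρ * a * C₁ * y * N with hW_def
  have hW0 : 0 ≤ W := by positivity
  have hk0 : ENNReal.ofReal (c / L ^ 2) ≠ 0 := by
    rw [ne_eq, ENNReal.ofReal_eq_zero, not_le]; positivity
  -- `4πρaN = R + W`, so `E ≤ ofReal R + (ofReal W + S)`
  have hsplit : 4 * Real.pi * ρ * a * N = R + W := by rw [hR_def, hW_def]; ring
  have hE' : neumannEnergy v Ψ ≤ ENNReal.ofReal R + (ENNReal.ofReal W + S) := by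
    refine hE.trans ?_
    rw [hsplit, ← add_assoc]
    exact add_le_add ENNReal.ofReal_add_le le_rfl
  have hcore := Junge2026_neumannBox_pinnedLowerBound.le_add_inv_mul_of_pinned
    ENNReal.ofReal_ne_top hk0 ENNReal.ofReal_ne_top hpin hE'
  refine hcore.trans (le_of_eq ?_)
  rw [mul_add, ← add_assoc, ← ENNReal.ofReal_inv_of_pos (by positivity), inv_div,
    ← ENNReal.ofReal_mul (by positivity)]
  congr 2
  rw [hW_def]
  field_simp

end Literature.MathematicalPhysics.QuantumManyBody.BoseGas

end
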